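import Summits.AnomalousDissipation.AnomalousDissipation.Theorems.TwoAndHalfDTwohalfdNegRegularCondensateLimitTools
import HarnessLib

/-!
# Sobolev-condensate no-go for `TwoAndHalfD.TwohalfdThesis` (stmt-AnomalousDissipation-0206), stub SC-LIM:
# the block limit solves the sourced TRANSPORT equation — Sobolev comparison flows

Crux `TwohalfdThesis` (= X), line `Sketch`, lead c7, section N of the skeleton (Sobolev condensates).  This is
the sibling crux's RC-LIM (`Theorems.TwohalfdNeg.RegularCondensate.stub_rcLimit`, 0211-c7) with two changes:
(i) the bounded continuous comparison flows `W k` converge to the limit flow `W'` only in `L²((0,S) × T²)`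
(`∫⁻ ‖W k − W'‖ₑ² → 0`), and `W'` is only jointly a.e. strongly measurable with, for a.e. `t ∈ (0,S)`, a slice
`W' t ∈ L²(T²)` of norm `≤ B`, weakly divergence free (no continuity, no pointwise bound); (ii) the weak
convergence `ϑ k ⇀ Θ` on the block is given against every `G ∈ L²((0,S) × T²)` (stub SC-WL2), not only
against bounded `G`.

Along levels `k`: restarted weak sourced scalars `ϑ k` on `[0, S+1)` (viscosities `ν k → 0`, drifts `v k`,
steady smooth source `h`), uniformly bounded in `L²((0,S) × T²)`, drifts `L²`-asymptotic to the `W k`; weak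
limits `Θ`, `Θ₀`.  THEN `Θ` is a weak solution of `∂ₜΘ + W'·∇Θ = h` on `T² × [0,S)` with datum `Θ₀`:
`Torus.IsWeakScalarTransportForcedOn S 0 W' (fun _ => h) Θ₀ Θ`.

Proof (DiPerna–Lions 1989, §II.1, stability of distributional solutions of a linear transport equation;
the model is `stub_rcLimit`).  Class conjuncts: measurability through `Torus.aestronglyMeasurable_stLift_of_uncurry`;
`∫₀^S ‖W'(t)‖_{L²} ≤ S·B`; `W' ∈ L²((0,S) × T²)` by Tonelli from the slice bounds, so `W'Θ ∈ L¹` as a product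
of two `L²` functions; weak incompressibility of a.e. slice is a hypothesis.  Weak identity: restrict the
level-`k` solutions to the horizon `S`, split
`ϑ(∂ₜψ + ⟪v, ∇ψ⟫ + νΔψ) = ϑ G + ϑ ⟪v − W', ∇ψ⟫ + ν ϑ Δψ`, `G = ∂ₜψ + ⟪W', ∇ψ⟫ + 0·Δψ`; now
`|G| ≤ K₁ + K₂‖W'‖` on the block, so `G ∈ L²` and the main pairing converges by (ii); `ν ∫∫ ϑ Δψ → 0`
(`Δψ` bounded, hence in `L²` of the finite block); the transport error tends to zero by Cauchy–Schwarz
(`rcLimit_tendsto_integral_mul_inner_of_eLpNorm`) since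
`‖v k − W'‖_{L²} ≤ ‖v k − W k‖_{L²} + ‖W k − W'‖_{L²} → 0`; datum and source terms as in the model.

* `scLimit_tendsto_eLpNorm_two` — `∫⁻ ‖f k‖ₑ² → 0 ⇒ ‖f k‖_{L²} → 0` (helper);
* `scLimit_tendsto_eLpNorm_drift_sub` — `L²` convergence of the drifts to the limit flow (helper);
* `stub_scLimit` — the registered stub (last declaration).  Supports stmt-AnomalousDissipation-0206.

## Mathlib / Literature search

`lean search 'MemLp.integrable_mul'`, `'tendsto_eLpNorm_two_of_tendsto_lintegral'`, `'memLp_two_uncurry'`: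
Mathlib's `MemLp.integrable_mul` / `MemLp.mono'` / `MemLp.of_bound` are used by name; the tree's
`FunctionSpaces.tendsto_eLpNorm_two_of_tendsto_lintegral_sq` (difference-to-a-fixed-limit form) and
`Torus.memLp_two_uncurry` (real-valued fields) do not fit (moving differences, vector fields) and the former is
not in the import closure, so the two short helpers below are proved from
`eLpNorm_two_eq_pow_two_rpow_half` / `eLpNorm_two_pow_two_eq_lintegral` as in the sibling tools file.

## References

* R. J. DiPerna, P.-L. Lions, Invent. Math. 98 (1989), §II.1. [`DiPernaLions1989`]
* T. D. Drivas, T. M. Elgindi, G. Iyer, I.-J. Jeong, ARMA 243 (2022), (1.1). [`DEIJ2022`]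
-/

namespace Summit.AnomalousDissipation.AnomalousDissipation.Theorems.TwohalfdThesis.SobolevCondensate

open MeasureTheory Filter Topology Set Function
open scoped ENNReal NNReal InnerProductSpace
open Literature.Analysis.FunctionSpaces Literature.Analysis.FluidPDE
open Summit.AnomalousDissipation.AnomalousDissipation.Theorems.TwohalfdNeg.RegularCondensate

set_option linter.dupNamespace false -- the registry path `AnomalousDissipation.AnomalousDissipation` (summit = problem)

/-! ## `L²` convergence from the `∫⁻ ‖·‖ₑ²` form -/

/-- `∫⁻ ‖f k‖ₑ² → 0` implies `‖f k‖_{L²} → 0` (continuity of `r ↦ r^{1/2}` at `0` in `ℝ≥0∞`).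
[folklore] -/
theorem scLimit_tendsto_eLpNorm_two {α : Type*} [MeasurableSpace α] {μ : Measure α}
    {E : Type*} [NormedAddCommGroup E] {f : ℕ → α → E}
    (h : Tendsto (fun k => ∫⁻ x, ‖f k x‖ₑ ^ 2 ∂μ) atTop (𝓝 0)) :
    Tendsto (fun k => eLpNorm (f k) 2 μ) atTop (𝓝 0) := by
  have h1 : ∀ k, eLpNorm (f k) 2 μ = (∫⁻ x, ‖f k x‖ₑ ^ 2 ∂μ) ^ (1 / 2 : ℝ) := fun k => by
    rw [eLpNorm_two_eq_pow_two_rpow_half, eLpNorm_two_pow_two_eq_lintegral]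
  simp_rw [h1]
  have h2 := ((ENNReal.continuous_rpow_const (y := (1 / 2 : ℝ))).tendsto 0).comp h
  rwa [ENNReal.zero_rpow_of_pos (by norm_num : (0 : ℝ) < 1 / 2)] at h2

/-- **`L²` convergence of the drifts to the limit flow.** If `v k − W k → 0` and `W k − W' → 0` in
`L²(μ)` (both in the `∫⁻ ‖·‖ₑ²` form), with `v k`, `W'` a.e. strongly measurable and `W k` jointly
continuous, then `‖v k − W'‖_{L²(μ)} → 0` (triangle inequality). [folklore] -/
theorem scLimit_tendsto_eLpNorm_drift_sub {X : Type*} [MeasurableSpace X] [TopologicalSpace X]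
    [OpensMeasurableSpace X] [TopologicalSpace.PseudoMetrizableSpace X] {μ : Measure X}
    {E : Type*} [NormedAddCommGroup E] [SecondCountableTopology E]
    {v W : ℕ → X → E} {W' : X → E}
    (hvm : ∀ k, AEStronglyMeasurable (v k) μ) (hWc : ∀ k, Continuous (W k))
    (hW'm : AEStronglyMeasurable W' μ)
    (hfl : Tendsto (fun k => ∫⁻ p, ‖v k p - W k p‖ₑ ^ 2 ∂μ) atTop (𝓝 0))
    (hWW' : Tendsto (fun k => ∫⁻ p, ‖W k p - W' p‖ₑ ^ 2 ∂μ) atTop (𝓝 0)) :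
    Tendsto (fun k => eLpNorm (fun p => v k p - W' p) 2 μ) atTop (𝓝 0) := by
  have he1 := scLimit_tendsto_eLpNorm_two (f := fun k p => v k p - W k p) hfl
  have he2 := scLimit_tendsto_eLpNorm_two (f := fun k p => W k p - W' p) hWW'
  have hsum := he1.add he2
  rw [add_zero] at hsum
  refine tendsto_of_tendsto_of_tendsto_of_le_of_le tendsto_const_nhds hsum (fun _ => zero_le)
    fun k => ?_
  have e : (fun p => v k p - W' p) = (fun p => v k p - W k p) + fun p => W k p - W' p := by
    funext p
    simp only [Pi.add_apply, sub_add_sub_cancel]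
  rw [e]
  exact eLpNorm_add_le ((hvm k).sub (hWc k).aestronglyMeasurable)
    ((hWc k).aestronglyMeasurable.sub hW'm) one_le_two

/-! ## The registered stub -/

/-- **SC-LIM `stub_scLimit` — the block limit solves the sourced TRANSPORT equation, Sobolev
comparison flows (registered stub).** Along a sequence of levels: restarted weak sourced scalars
`ϑ k` on `[0, S+1)` (viscosities `ν k → 0`, drifts `v k`, the same steady smooth source `h`, `L²`
data `ϑ₀ k`), uniformly bounded in `L²((0,S) × T²)`, whose drifts are `L²((0,S) × T²)`-asymptotic
to bounded continuous comparison flows `W k` converging in `L²((0,S) × T²)` to a jointly measurable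
`W'` with, for a.e. `t ∈ (0,S)`, `W' t ∈ L²` of norm `≤ B` and weakly divergence free; and weak
limits `Θ` (against `L²((0,S) × T²)`) and `Θ₀` (against `L²(T²)`) with the class bounds. THEN `Θ`
is a weak solution of `∂ₜΘ + W'·∇Θ = h` on `T² × [0, S)` with datum `Θ₀`. DiPerna–Lions passage
to the limit in the linear transport equation: `ϑ(∂ₜψ + ⟪v,∇ψ⟫ + νΔψ) = ϑG + ϑ⟪v − W',∇ψ⟫ + νϑΔψ`
with `G = ∂ₜψ + ⟪W',∇ψ⟫ ∈ L²`, `‖v k − W'‖_{L²} ≤ ‖v k − W k‖ + ‖W k − W'‖ → 0`, `ν k ∫∫ ϑ Δψ → 0`.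
[cite: DiPernaLions1989, §II.1] -/
theorem stub_scLimit :
    ∀ (S : ℝ) (B C C₁ : ℝ) (h : UnitAddTorus (Fin 2) → ℝ) (ν : ℕ → ℝ)
      (v W : ℕ → ℝ → UnitAddTorus (Fin 2) → EuclideanSpace ℝ (Fin 2))
      (W' : ℝ → UnitAddTorus (Fin 2) → EuclideanSpace ℝ (Fin 2))
      (ϑ₀ : ℕ → UnitAddTorus (Fin 2) → ℝ) (ϑ : ℕ → ℝ → UnitAddTorus (Fin 2) → ℝ)
      (Θ₀ : UnitAddTorus (Fin 2) → ℝ) (Θ : ℝ → UnitAddTorus (Fin 2) → ℝ),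
      0 < S → Torus.IsSmooth h → Tendsto ν atTop (𝓝 0) →
      (∀ k, MemLp (ϑ₀ k) 2 volume) →
      (∀ k, Torus.IsWeakScalarTransportForcedOn (S + 1) (ν k) (v k) (fun _ => h) (ϑ₀ k) (ϑ k)) →
      (∀ k, Integrable (fun p : ℝ × UnitAddTorus (Fin 2) => ϑ k p.1 p.2 ^ 2)
        (((volume : Measure ℝ).restrict (Set.Ioo 0 S)).prod volume)) →
      (∀ k, ∫ p, ϑ k p.1 p.2 ^ 2 ∂(((volume : Measure ℝ).restrict (Set.Ioo 0 S)).prod volume) ≤ C) →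
      (∀ k, Continuous (Function.uncurry (W k))) → (∀ k t x, ‖W k t x‖ ≤ B) →
      Tendsto (fun k => ∫⁻ p, ‖v k p.1 p.2 - W k p.1 p.2‖ₑ ^ 2
        ∂(((volume : Measure ℝ).restrict (Set.Ioo 0 S)).prod volume)) atTop (𝓝 0) →
      AEStronglyMeasurable (Function.uncurry W') (((volume : Measure ℝ).restrict (Set.Ioo 0 S)).prod volume) →
      (∀ᵐ t ∂(volume.restrict (Set.Ioo 0 S)), MemLp (W' t) 2 volume ∧
        eLpNorm (W' t) 2 volume ≤ ENNReal.ofReal B ∧ Torus.IsWeaklyDivFree (W' t)) →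
      Tendsto (fun k => ∫⁻ p, ‖W k p.1 p.2 - W' p.1 p.2‖ₑ ^ 2
        ∂(((volume : Measure ℝ).restrict (Set.Ioo 0 S)).prod volume)) atTop (𝓝 0) →
      AEStronglyMeasurable (Function.uncurry Θ) (((volume : Measure ℝ).restrict (Set.Ioo 0 S)).prod volume) →
      Integrable (fun p : ℝ × UnitAddTorus (Fin 2) => Θ p.1 p.2 ^ 2)
        (((volume : Measure ℝ).restrict (Set.Ioo 0 S)).prod volume) →
      (∀ᵐ t ∂(volume.restrict (Set.Ioo 0 S)), ∫ x, Θ t x ^ 2 ≤ C₁) →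
      MemLp Θ₀ 2 volume →
      (∀ G : ℝ × UnitAddTorus (Fin 2) → ℝ,
        MemLp G 2 (((volume : Measure ℝ).restrict (Set.Ioo 0 S)).prod volume) →
        Tendsto (fun k => ∫ p, ϑ k p.1 p.2 * G p ∂(((volume : Measure ℝ).restrict (Set.Ioo 0 S)).prod volume))
          atTop (𝓝 (∫ p, Θ p.1 p.2 * G p ∂(((volume : Measure ℝ).restrict (Set.Ioo 0 S)).prod volume)))) →
      (∀ w : UnitAddTorus (Fin 2) → ℝ, MemLp w 2 volume →
        Tendsto (fun k => ∫ x, ϑ₀ k x * w x) atTop (𝓝 (∫ x, Θ₀ x * w x))) →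
      Torus.IsWeakScalarTransportForcedOn S 0 W' (fun _ => h) Θ₀ Θ := by
  intro S B C C₁ h ν v W W' ϑ₀ ϑ Θ₀ Θ hS hh hν _hϑ₀ hsol hϑsq hϑC hWc _hWB hfl hW'm hW'ae hWW'
    hΘm hΘsq hΘC₁ _hΘ₀ hwlim hwlim₀
  -- the block measure
  set μ : Measure (ℝ × UnitAddTorus (Fin 2)) :=
    ((volume : Measure ℝ).restrict (Ioo 0 S)).prod (volume : Measure (UnitAddTorus (Fin 2))) with hμ
  haveI : IsFiniteMeasure ((volume : Measure ℝ).restrict (Ioo 0 S)) :=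
    isFiniteMeasure_restrict.2 measure_Ioo_lt_top.ne
  haveI : IsFiniteMeasure μ := by rw [hμ]; infer_instance
  have hae : ∀ᵐ p ∂μ, p.1 ∈ Ioo 0 S := Torus.IsWeakScalarTransportForcedOn.ae_fst_mem_Ioo S
  -- the level-`k` solutions restricted to the horizon `S`
  have hsol' : ∀ k, Torus.IsWeakScalarTransportForcedOn S (ν k) (v k) (fun _ => h) (ϑ₀ k) (ϑ k) :=
    fun k => rcLimit_isWeakScalarTransportForcedOn_of_le (hsol k) (by linarith)
  -- the limit and the level-`k` scalars are in `L²` on the block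
  have hΘL2 : MemLp (uncurry Θ) 2 μ := (memLp_two_iff_integrable_sq hΘm).2 hΘsq
  have hϑm : ∀ k, AEStronglyMeasurable (uncurry (ϑ k)) μ := fun k =>
    (hsol' k).aestronglyMeasurable_uncurry
  have hϑL2 : ∀ k, MemLp (uncurry (ϑ k)) 2 μ := fun k =>
    (memLp_two_iff_integrable_sq (hϑm k)).2 (hϑsq k)
  have hhc : Continuous h := hh.continuous
  -- the limit flow: slice bounds in the `∫⁻ ‖·‖ₑ²` form, and `W' ∈ L²` on the block (Tonelli)
  have hW'sl : ∀ᵐ t ∂((volume : Measure ℝ).restrict (Ioo 0 S)),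
      ∫⁻ x, ‖W' t x‖ₑ ^ 2 ≤ ENNReal.ofReal B ^ 2 := by
    filter_upwards [hW'ae] with t ht
    rw [← eLpNorm_two_pow_two_eq_lintegral]
    gcongr
    exact ht.2.1
  have hW'T : ∫⁻ t in Ioo 0 S, ∫⁻ x, ‖W' t x‖ₑ ^ 2 < ⊤ :=
    calc ∫⁻ t in Ioo 0 S, ∫⁻ x, ‖W' t x‖ₑ ^ 2
        ≤ ∫⁻ _ in Ioo 0 S, ENNReal.ofReal B ^ 2 := lintegral_mono_ae hW'sl
      _ < ⊤ := by
          rw [setLIntegral_const]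
          exact ENNReal.mul_lt_top (ENNReal.pow_lt_top ENNReal.ofReal_lt_top) measure_Ioo_lt_top
  have hW'L2 : MemLp (uncurry W') 2 μ := by
    refine ⟨hW'm, ?_⟩
    rw [eLpNorm_two_eq_pow_two_rpow_half, eLpNorm_two_pow_two_eq_lintegral,
      lintegral_prod _ (hW'm.aemeasurable.enorm.pow_const 2)]
    exact ENNReal.rpow_lt_top_of_nonneg (by norm_num) hW'T.ne
  refine ⟨Torus.aestronglyMeasurable_stLift_of_uncurry hΘm,
    Torus.aestronglyMeasurable_stLift_of_uncurry hW'm,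
    Torus.aestronglyMeasurable_stLift_of_uncurry (u := fun _ => h)
      (hhc.comp continuous_snd).aestronglyMeasurable,
    ⟨C₁.toNNReal, ?_⟩, ?_, ?_, ?_, hW'ae.mono fun t ht => ht.2.2, fun ψ hψ => ?_⟩
  · -- `Θ ∈ L^∞(0,S; L²)`
    filter_upwards [hΘC₁, hΘsq.prod_right_ae] with t ht hint
    have hint' : Integrable (fun y => Θ t y ^ 2) volume := hint
    rw [rcWeakLimit_lintegral_enorm_sq_eq hint']
    exact ENNReal.ofReal_le_ofReal ht
  · -- `W' ∈ L¹(0,S; L²)`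
    calc ∫⁻ t in Ioo 0 S, (∫⁻ x, ‖W' t x‖ₑ ^ 2) ^ (1 / 2 : ℝ)
        ≤ ∫⁻ _ in Ioo 0 S, ENNReal.ofReal B := by
          refine lintegral_mono_ae ?_
          filter_upwards [hW'ae] with t ht
          rw [← eLpNorm_two_pow_two_eq_lintegral, ← eLpNorm_two_eq_pow_two_rpow_half]
          exact ht.2.1
      _ < ⊤ := by
          rw [setLIntegral_const]
          exact ENNReal.mul_lt_top ENNReal.ofReal_lt_top measure_Ioo_lt_top
  · -- `W' Θ ∈ L¹((0,S) × T²)`: product of two `L²` functions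
    have hm : AEMeasurable (fun p : ℝ × UnitAddTorus (Fin 2) => ‖W' p.1 p.2‖ₑ * ‖Θ p.1 p.2‖ₑ) μ :=
      hW'm.enorm.mul hΘm.enorm
    have hI := (MemLp.integrable_mul hW'L2.norm hΘL2.norm).2
    rw [hasFiniteIntegral_iff_enorm] at hI
    calc ∫⁻ t in Ioo 0 S, ∫⁻ x, ‖W' t x‖ₑ * ‖Θ t x‖ₑ
        = ∫⁻ p, ‖W' p.1 p.2‖ₑ * ‖Θ p.1 p.2‖ₑ ∂μ := (lintegral_prod _ hm).symm
      _ = ∫⁻ p, ‖((fun p => ‖uncurry W' p‖) * fun p => ‖uncurry Θ p‖) p‖ₑ ∂μ := by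
          refine lintegral_congr fun p => ?_
          rw [Pi.mul_apply, enorm_mul, enorm_norm, enorm_norm]
          rfl
      _ < ⊤ := hI
  · -- `h ∈ L¹((0,S) × T²)`
    show ∫⁻ _ in Ioo 0 S, ∫⁻ x, ‖h x‖ₑ < ⊤
    rw [setLIntegral_const]
    exact ENNReal.mul_lt_top hhc.integrable_unitAddTorus.2 measure_Ioo_lt_top
  · -- ### the weak identity
    -- bounds on the test function over `[0,S] × T²`
    obtain ⟨K₁, hK₁⟩ := Torus.exists_bound_of_continuous_uncurry hψ.continuous_uncurry_timeDeriv 0 S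
    obtain ⟨K₂, hK₂⟩ := Torus.exists_bound_of_continuous_uncurry hψ.continuous_uncurry_gradient 0 S
    obtain ⟨K₃, hK₃⟩ := Torus.exists_bound_of_continuous_uncurry hψ.continuous_uncurry_laplacian 0 S
    have hψc : Continuous (uncurry ψ) := Torus.continuous_uncurry_of_continuous_stLift hψ.1.continuous
    obtain ⟨K₀, hK₀⟩ := Torus.exists_bound_of_continuous_uncurry hψc 0 S
    have hψ0c : Continuous (ψ 0) := hψc.comp (Continuous.prodMk_right 0)
    -- the pieces of the weak integrand
    set G : ℝ × UnitAddTorus (Fin 2) → ℝ := fun p =>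
      Torus.timeDeriv ψ p.1 p.2 + ⟪W' p.1 p.2, Torus.gradient (ψ p.1) p.2⟫_ℝ +
        0 * Torus.laplacian (ψ p.1) p.2 with hG
    set Lp : ℝ × UnitAddTorus (Fin 2) → ℝ := fun p => Torus.laplacian (ψ p.1) p.2 with hLp
    set H : ℕ → ℝ × UnitAddTorus (Fin 2) → ℝ := fun k p =>
      ⟪v k p.1 p.2 - W' p.1 p.2, Torus.gradient (ψ p.1) p.2⟫_ℝ with hH
    have hGm : AEStronglyMeasurable G μ := by
      refine ((?_ : AEStronglyMeasurable _ _).add ?_).add ?_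
      · exact hψ.continuous_uncurry_timeDeriv.aestronglyMeasurable
      · exact hW'm.inner hψ.continuous_uncurry_gradient.aestronglyMeasurable
      · exact (continuous_const.mul hψ.continuous_uncurry_laplacian).aestronglyMeasurable
    -- `|G| ≤ K₁ + K₂ ‖W'‖` on the block, so `G ∈ L²`
    have hGbd : ∀ᵐ p ∂μ, ‖G p‖ ≤ K₁ + K₂ * ‖uncurry W' p‖ := by
      filter_upwards [hae] with p hp
      have hp' : p.1 ∈ Icc 0 S := Ioo_subset_Icc_self hp
      have h1 : |Torus.timeDeriv ψ p.1 p.2| ≤ K₁ := by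
        rw [← Real.norm_eq_abs]; exact hK₁ p.1 hp' p.2
      have h2 : |⟪W' p.1 p.2, Torus.gradient (ψ p.1) p.2⟫_ℝ| ≤ ‖W' p.1 p.2‖ * K₂ :=
        (abs_real_inner_le_norm _ _).trans
          (mul_le_mul_of_nonneg_left (hK₂ p.1 hp' p.2) (norm_nonneg _))
      rw [Real.norm_eq_abs]
      simp only [hG, zero_mul, add_zero]
      exact (abs_add_le _ _).trans (add_le_add h1 (h2.trans_eq (mul_comm _ _)))
    have hGL2 : MemLp G 2 μ := ((memLp_const K₁).add (hW'L2.norm.const_mul K₂)).mono' hGm hGbd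
    have hLpm : AEStronglyMeasurable Lp μ := hψ.continuous_uncurry_laplacian.aestronglyMeasurable
    have hLpbd' : ∀ᵐ p ∂μ, ‖Lp p‖ ≤ K₃ := by
      filter_upwards [hae] with p hp
      exact hK₃ p.1 (Ioo_subset_Icc_self hp) p.2
    have hLpL2 : MemLp Lp 2 μ := MemLp.of_bound hLpm K₃ hLpbd'
    -- (a) weak convergence of the main pairing and of the Laplacian pairing (against `L²`)
    have hA : Tendsto (fun k => ∫ p, ϑ k p.1 p.2 * G p ∂μ) atTop (𝓝 (∫ p, Θ p.1 p.2 * G p ∂μ)) :=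
      hwlim G hGL2
    have hB : Tendsto (fun k => ν k * ∫ p, ϑ k p.1 p.2 * Lp p ∂μ) atTop (𝓝 0) := by
      have h1 := hν.mul (hwlim Lp hLpL2)
      rwa [zero_mul] at h1
    -- (b) the transport error
    have hvm : ∀ k, AEStronglyMeasurable (uncurry (v k)) μ := fun k =>
      (hsol' k).aestronglyMeasurable_uncurry_velocity
    have hdm : ∀ k, AEStronglyMeasurable
        (fun q : ℝ × UnitAddTorus (Fin 2) => v k q.1 q.2 - W' q.1 q.2) μ := fun k =>
      (hvm k).sub hW'm
    have hdrift : Tendsto (fun k => eLpNorm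
        (fun q : ℝ × UnitAddTorus (Fin 2) => v k q.1 q.2 - W' q.1 q.2) 2 μ) atTop (𝓝 0) :=
      scLimit_tendsto_eLpNorm_drift_sub (v := fun k => uncurry (v k)) (W := fun k => uncurry (W k))
        (W' := uncurry W') hvm hWc hW'm hfl hWW'
    have hgbd : ∀ᵐ p ∂μ, ‖Torus.gradient (ψ p.1) p.2‖ ≤ K₂ := by
      filter_upwards [hae] with p hp
      exact hK₂ p.1 (Ioo_subset_Icc_self hp) p.2
    have hJ : Tendsto (fun k => ∫ p, ϑ k p.1 p.2 * H k p ∂μ) atTop (𝓝 0) :=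
      rcLimit_tendsto_integral_mul_inner_of_eLpNorm (f := fun k => uncurry (ϑ k)) hϑm
        (ENNReal.rpow_ne_top_of_nonneg (by norm_num) ENNReal.ofReal_ne_top)
        (fun k => rcLimit_eLpNorm_two_le_of_integral_sq_le (hϑsq k) (hϑC k)) hdm hdrift hgbd
    -- (c) the datum term
    have hψ0L2 : MemLp (ψ 0) 2 volume :=
      MemLp.of_bound hψ0c.aestronglyMeasurable K₀ (ae_of_all _ fun x => hK₀ 0 ⟨le_rfl, hS.le⟩ x)
    have hD := hwlim₀ (ψ 0) hψ0L2
    -- (d) the level-`k` identities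
    have hIsrc : Integrable (fun p : ℝ × UnitAddTorus (Fin 2) => h p.2 * ψ p.1 p.2) μ :=
      (hsol' 0).integrable_source_mul_test hψ
    have hident : ∀ k, ∫ p, ϑ k p.1 p.2 * G p ∂μ =
        -(∫ p, ϑ k p.1 p.2 * H k p ∂μ) - ν k * (∫ p, ϑ k p.1 p.2 * Lp p ∂μ) -
          (∫ p, h p.2 * ψ p.1 p.2 ∂μ) - ∫ x, ϑ₀ k x * ψ 0 x := by
      intro k
      have h0 := (hsol' k).integral_prod_weak_eq hψ
      have hIG : Integrable (fun p : ℝ × UnitAddTorus (Fin 2) => ϑ k p.1 p.2 * G p) μ :=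
        (hϑL2 k).integrable_mul hGL2
      have hIL : Integrable (fun p : ℝ × UnitAddTorus (Fin 2) => ϑ k p.1 p.2 * Lp p) μ :=
        (hsol' k).integrable_uncurry.mul_bdd hLpm hLpbd'
      have hIsum := (hsol' k).integrable_weakIntegrand hψ
      have hsplit : ∀ p : ℝ × UnitAddTorus (Fin 2), ϑ k p.1 p.2 *
          (Torus.timeDeriv ψ p.1 p.2 + ⟪v k p.1 p.2, Torus.gradient (ψ p.1) p.2⟫_ℝ +
            ν k * Torus.laplacian (ψ p.1) p.2) =
          ϑ k p.1 p.2 * G p + ϑ k p.1 p.2 * H k p + ν k * (ϑ k p.1 p.2 * Lp p) := by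
        intro p
        simp only [hG, hH, hLp, inner_sub_left]
        ring
      have hIH : Integrable (fun p : ℝ × UnitAddTorus (Fin 2) => ϑ k p.1 p.2 * H k p) μ := by
        refine ((hIsum.sub hIG).sub (hIL.const_mul (ν k))).congr (Eventually.of_forall fun p => ?_)
        simp only [Pi.sub_apply, hsplit p]
        ring
      have hIGH : Integrable
          (fun p : ℝ × UnitAddTorus (Fin 2) => ϑ k p.1 p.2 * G p + ϑ k p.1 p.2 * H k p) μ :=
        hIG.add hIH
      have h1 : (∫ p, ϑ k p.1 p.2 *
          (Torus.timeDeriv ψ p.1 p.2 + ⟪v k p.1 p.2, Torus.gradient (ψ p.1) p.2⟫_ℝ +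
            ν k * Torus.laplacian (ψ p.1) p.2) ∂μ) =
          (∫ p, ϑ k p.1 p.2 * G p ∂μ) + (∫ p, ϑ k p.1 p.2 * H k p ∂μ) +
            ν k * ∫ p, ϑ k p.1 p.2 * Lp p ∂μ := by
        rw [← integral_const_mul, ← integral_add hIG hIH,
          ← integral_add hIGH (hIL.const_mul _)]
        exact integral_congr_ae (Eventually.of_forall fun p => hsplit p)
      rw [h1] at h0
      linarith
    -- (e) pass to the limit
    have hlimit : Tendsto (fun k => ∫ p, ϑ k p.1 p.2 * G p ∂μ) atTop
        (𝓝 (-(0 : ℝ) - 0 - (∫ p, h p.2 * ψ p.1 p.2 ∂μ) - ∫ x, Θ₀ x * ψ 0 x)) :=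
      (((hJ.neg.sub hB).sub (tendsto_const_nhds (x := ∫ p, h p.2 * ψ p.1 p.2 ∂μ))).sub hD).congr
        fun k => (hident k).symm
    have hGeq := tendsto_nhds_unique hA hlimit
    have hIΘG : Integrable (fun p : ℝ × UnitAddTorus (Fin 2) => Θ p.1 p.2 * G p) μ :=
      hΘL2.integrable_mul hGL2
    have key : (∫ p, Θ p.1 p.2 * G p ∂μ) + (∫ p, h p.2 * ψ p.1 p.2 ∂μ) + ∫ x, Θ₀ x * ψ 0 x = 0 := by
      rw [hGeq]; ring
    rw [integral_prod _ hIΘG, integral_prod _ hIsrc] at key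
    exact key

end Summit.AnomalousDissipation.AnomalousDissipation.Theorems.TwohalfdThesis.SobolevCondensate
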